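import Summits.QuantumFields.YangMills.Theorems.FluctuationComparisonRegPrIntLS2BetaChartReadDerivCovLinAvg
import Summits.QuantumFields.YangMills.Theorems.BalabanUVNodesN09CentralWindowInjective
import HarnessLib

/-!
# S2β · (β-1) THE COMPLEXIFICATION OF THE ONE-STEP CHART-READ (0.4) EML AVERAGE: ENTIRE STEP FACTORS AND WALK PRODUCTS, AND THE RELATIVE AVERAGE `G_c(A)` IS WITHIN
# `27·ℓ·(e^{‖A‖} − 1)` OF `1` ON THE SUP-NORM POLYDISC `100·ℓ·(e^{‖A‖} − 1) ≤ ρ` ([Balaban1985Averaging] Prop. 3 p.36 «Q(V₀, A, c) … is an analytic function of A» — the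
# HYPOTHESIS of print's Cauchy road to (123) `|C(V₀, A, c)| ≤ C₁L²|A|²`, typed for the tree's own averaging)

Cell `ym3-torus` (YM ladder rung R3 = continuum `SU(2)` Yang–Mills on the three-torus at fixed lattice data — a RUNG: NOT d = 4, NOT infinite volume, NOT a mass gap,
NOT Clay).  Width seat `ym3-torus-px13` (gen 26); crux `stmt-QuantumFields-20520` (`…Theses.UnitScaleTilt.FluctuationComparisonRegPrIntL`), LINE g18-1 S2β, pairing lane
«CRIT-ax» ⟸ «MULT♭-ax» ⟸ `multAx_of_letters` (px5 ✓p825995) ⟸ {Thm-1 pair, (RINV-curl)_q ✓p827199, AVG₂♭-ax_q}; AVG₂♭-ax_q's route (UV3-NODE §89.7) step (2) = THE ORDER-2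
ONE-STEP BRICK «`|ψ(A)_c − (Dψ(0)A)_c| ≤ C₁·(ℓ|A|)²`» for the chart-read one-step average `ψ_{U₀}(A)(c) = Λ(Ū(Θ^B(A)·U₀)(c)·Ū(U₀)(c)⁻¹)` of pub-ymgap N09 ∕ (D1) ✓p824693.
THIS FILE is the brick's first half by PRINT'S OWN ROAD (complexify, then Cauchy): `--kind proof --supports stmt-QuantumFields-20520 --as helper`, count-neutral,
DEFINITION-FREE (0 `def` ∕ `instance` ∕ `notation` ∕ `sorry`; the complex objects are written out as terms in every statement).

OBJECTS (generic `P : Params`, `SU(N)`, level `j`; `M = M_N(ℂ)` with the `L²`-operator norm; `U₀ : GaugeField P j (SU N)`; a COMPLEX bond field `A : PBond P j → M`).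
* complexified step factor `σ_A(s) = e^{A_b}·↑U₀(b)` (forward step on `b`), `= ↑U₀(b)⋆·e^{−A_b}` (backward) — the HOLOMORPHIC extension of lit `Node00.stepM` off the real slice
  (`stepM` takes the adjoint, which is anti-holomorphic; on `𝔰𝔲(N)`-valued `A = X̂` the two agree, `stepC_real`, since `X_b⋆ = −X_b`); walk product `W_A(γ) = ∏_{s∈γ} σ_A(s)`;
* at a coarse bond `c`: the loop tuple `i ↦ W_A(loop_i)` over `Idx P`, the straight segment `W_A([c₋,c₊])`, and the RELATIVE AVERAGE `G_c(A) = eml(i ↦ W_A(loop_i))·W_A([c₋,c₊])·↑Ū(U₀)(c)⋆`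
  (`eml` = lit `ExpMeanLog.eml`, the UNGUARDED analytic `exp[mean log]`; on the real slice inside the guard `G_c(X̂) = ↑(Ū(Θ^B(X)·U₀)(c)·Ū(U₀)(c)⁻¹)`, proved in (β-2)).

WHAT IS PROVED (sorry-free; `ℓ = (d+2)L` bounds every (0.4) word, lit `length_loopWord_le`).
* §1 generic: `norm_list_map_prod_sub_le` (`‖∏f − ∏g‖ ≤ (1+δ)^{|l|} − 1` for factorwise `δ`-close products with `‖g_s‖ ≤ 1`), `analyticAt_list_map_prod`, `one_add_pow_sub_one_le`.
* §2 steps: `analyticAt_stepC` (entire), `norm_stepC_sub_stepM_le` (`≤ e^{‖A‖} − 1`), `stepC_zero`, ★`stepC_real`.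
* §3 walks: `analyticAt_holC`, ★`norm_holC_sub_holM_le` (`‖W_A(γ) − holM ↑U₀ γ‖ ≤ e^{|γ|‖A‖} − 1`), `holC_zero`, ★`holC_real`, `exp_pow_sub_one_le` (`≤ 2ℓ(e^{‖A‖} − 1)`).
* §4 ★★`norm_cplxRelAvg_sub_one_le`: for `U₀` in the loop `α`-guard at `c` (`dist1 (loopHol U₀ c i) ≤ α`, `4α ≤ ρ ≤ innerRadius` of the `SU(N)` log chart) and
  `100·ℓ·(e^{‖A‖} − 1) ≤ ρ`:  **`‖G_c(A) − 1‖ ≤ 27·ℓ·(e^{‖A‖} − 1)`** (`eml` is `12`-Lipschitz on its polydisc, lit `norm_eml_add_sub_eml_le`; `G_c(0) = 1` by lit `coe_avgFun_of_small`);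
  `innerRadius_le_deltaSU`, `norm_loopTupleC_sub_le`, `norm_loopM_tuple_sub_one_le`, `norm_axialC_sub_le`.
Sequels: (β-2) `…ChartReadCplxAnalytic` (`Φ_c = log ∘ G_c` holomorphic + bounded on the polydisc, = `↑ψ_{U₀}(·)(c)` on the real slice), (β-3) `…ChartReadSecondOrder` (the brick).
HONEST.  Kernel calculus ∕ bookkeeping on the tree's OWN (0.4) averaging (products, `exp`, the analytic `eml`); ONE printed clause («analytic function of A») made quantitative
for the tree's `ψ`; NO estimate of Bałaban's renormalisation analysis; (123) itself is (β-3), NOT here; the pair-weight structure of §89.4, the k-step letter AVG₂♭-ax_q, Q6∕Q7,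
«MULT♭-ax»∕«CRIT-ax», (D-ax)∕(F-ax), GAP♯∘ (registry UNTOUCHED), the five REGISTERED stubs, S2β, crux 20520, 19936, 19200 and `YM3TorusSU2` are NOT proved; no summit
statement is proved by a helper; rung R3 = SU(2) YM₃ on T³ at fixed lattice data — NOT d = 4, NOT infinite volume, NOT a mass gap, NOT Clay; the Yang–Mills mass gap is NOT
proved.  Axioms standard.

References: [Balaban1985Averaging] CMP **98** (1985) Prop. 3 (121)–(123) p.36, (19) p.21; [Balaban1987RG1] CMP **109** (1987) (0.4), (0.8) p.253; [Helgason2000] Ch. I §1 Thm 1.14.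
-/
set_option autoImplicit false
noncomputable section

open scoped Matrix.Norms.L2Operator Topology
open Filter Set Function Metric

namespace Summit.QuantumFields.YangMills.Theorems.FluctuationComparisonRegPrIntLS2BetaChartReadCplxExtension

open Literature.MathematicalPhysics.QuantumFieldTheory.Balaban1983to89
open Literature.MathematicalPhysics.QuantumFieldTheory.Balaban1983to89.HaarExponentialChart
open Literature.MathematicalPhysics.QuantumFieldTheory.Balaban1983to89.HaarExponentialChart.IsChartRep
open Literature.MathematicalPhysics.QuantumFieldTheory.Balaban1983to89.BlockAveraging (Small Idx avgFun loopHol off corr)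
open Literature.MathematicalPhysics.QuantumFieldTheory.Balaban1983to89.ExpMeanLog (eml expMeanLogSU deltaSU deltaSU_pos)
open Literature.MathematicalPhysics.QuantumFieldTheory.Balaban1983to89.BlockAveragingEMLLinearised (length_walk length_walk_replicate_le)
open Literature.MathematicalPhysics.QuantumFieldTheory.Balaban1983to89.LatticeWordStokes (length_loopWord_le)
open MatrixLog (mlog)
open Literature.MathematicalPhysics.QuantumFieldTheory.Balaban1983to89.Node00
open Literature.MathematicalPhysics.QuantumFieldTheory.Balaban1983to89.T4Continuum (walk holAt LStep loopWord holAt_nil holAt_cons)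
open Summit.QuantumFields.YangMills.BalabanUVNodes.N09ChartReadAveragingSmooth
open Summit.QuantumFields.YangMills.BalabanUVNodes.N09CentralWindowInjective (norm_coe_SU_le_one)

/-! ## §1 Generic letters: walk products in a normed ring, two real inequalities -/

section Generic

variable {σ : Type*} {𝔸 : Type*} [NormedRing 𝔸] [NormOneClass 𝔸]

/-- A product of factors of norm `≤ 1` has norm `≤ 1`. [folklore] -/
theorem norm_list_map_prod_le_one (l : List σ) (g : σ → 𝔸) (hg : ∀ s ∈ l, ‖g s‖ ≤ 1) : ‖(l.map g).prod‖ ≤ 1 := by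
  induction l with
  | nil => simp
  | cons s l ih =>
    rw [List.map_cons, List.prod_cons]
    have h1 : ‖g s‖ ≤ 1 := hg s (by simp)
    have h2 : ‖(l.map g).prod‖ ≤ 1 := ih fun t ht => hg t (by simp [ht])
    calc ‖g s * (l.map g).prod‖ ≤ ‖g s‖ * ‖(l.map g).prod‖ := norm_mul_le _ _
      _ ≤ 1 * 1 := mul_le_mul h1 h2 (norm_nonneg _) zero_le_one
      _ = 1 := one_mul 1

/-- **Perturbed walk products**: if every factor of `f` is within `δ` of the corresponding factor of `g` and the factors of `g` have norm `≤ 1`, then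
`‖∏ f − ∏ g‖ ≤ (1 + δ)^{|l|} − 1` (the zeroth-order form of lit `BlockAveragingEMLLinearisedBackground.norm_holRatio_bounds`, in a general normed ring). [folklore] -/
theorem norm_list_map_prod_sub_le (l : List σ) (f g : σ → 𝔸) {δ : ℝ} (hδ : 0 ≤ δ) (hfg : ∀ s ∈ l, ‖f s - g s‖ ≤ δ)
    (hg : ∀ s ∈ l, ‖g s‖ ≤ 1) : ‖(l.map f).prod - (l.map g).prod‖ ≤ (1 + δ) ^ l.length - 1 := by
  induction l with
  | nil => simp
  | cons s l ih =>
    rw [List.map_cons, List.map_cons, List.prod_cons, List.prod_cons, List.length_cons]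
    have hfs : ‖f s - g s‖ ≤ δ := hfg s (by simp)
    have hgs : ‖g s‖ ≤ 1 := hg s (by simp)
    have ih' : ‖(l.map f).prod - (l.map g).prod‖ ≤ (1 + δ) ^ l.length - 1 :=
      ih (fun t ht => hfg t (by simp [ht])) (fun t ht => hg t (by simp [ht]))
    have hPg : ‖(l.map g).prod‖ ≤ 1 := norm_list_map_prod_le_one l g fun t ht => hg t (by simp [ht])
    have hPf : ‖(l.map f).prod‖ ≤ (1 + δ) ^ l.length := by
      calc ‖(l.map f).prod‖ = ‖(l.map g).prod + ((l.map f).prod - (l.map g).prod)‖ := by rw [add_sub_cancel]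
        _ ≤ ‖(l.map g).prod‖ + ‖(l.map f).prod - (l.map g).prod‖ := norm_add_le _ _
        _ ≤ 1 + ((1 + δ) ^ l.length - 1) := add_le_add hPg ih'
        _ = (1 + δ) ^ l.length := by ring
    have hsplit : f s * (l.map f).prod - g s * (l.map g).prod =
        (f s - g s) * (l.map f).prod + g s * ((l.map f).prod - (l.map g).prod) := by noncomm_ring
    have hp0 : 0 ≤ (1 + δ) ^ l.length := pow_nonneg (by linarith) _
    calc ‖f s * (l.map f).prod - g s * (l.map g).prod‖
        = ‖(f s - g s) * (l.map f).prod + g s * ((l.map f).prod - (l.map g).prod)‖ := by rw [hsplit]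
      _ ≤ ‖f s - g s‖ * ‖(l.map f).prod‖ + ‖g s‖ * ‖(l.map f).prod - (l.map g).prod‖ :=
          (norm_add_le _ _).trans (add_le_add (norm_mul_le _ _) (norm_mul_le _ _))
      _ ≤ δ * (1 + δ) ^ l.length + 1 * ((1 + δ) ^ l.length - 1) :=
          add_le_add (mul_le_mul hfs hPf (norm_nonneg _) hδ) (mul_le_mul hgs ih' (norm_nonneg _) zero_le_one)
      _ = (1 + δ) ^ (l.length + 1) - 1 := by ring

end Generic
section GenericDiff

variable {σ : Type*} {𝕜 : Type*} [NontriviallyNormedField 𝕜] {E : Type*} [NormedAddCommGroup E] [NormedSpace 𝕜 E]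
  {𝔸 : Type*} [NormedRing 𝔸] [NormedAlgebra 𝕜 𝔸]

/-- A walk product of analytic factors is analytic. [folklore] -/
theorem analyticAt_list_map_prod (l : List σ) {F : σ → E → 𝔸} {x : E} (h : ∀ s ∈ l, AnalyticAt 𝕜 (F s) x) :
    AnalyticAt 𝕜 (fun y => (l.map fun s => F s y).prod) x := by
  induction l with
  | nil => simp only [List.map_nil, List.prod_nil]; exact analyticAt_const
  | cons s l ih =>
    have hfun : (fun y => ((s :: l).map fun t => F t y).prod) = fun y => F s y * (l.map fun t => F t y).prod := by
      funext y; rw [List.map_cons, List.prod_cons]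
    rw [hfun]
    exact (h s (by simp)).mul (ih fun t ht => h t (by simp [ht]))

end GenericDiff
section RealIneq

/-- `(1 + δ)^m − 1 ≤ 2mδ` when `δ ≥ 0` and `mδ ≤ 1∕2`. [folklore] -/
theorem one_add_pow_sub_one_le {δ : ℝ} (hδ : 0 ≤ δ) {m : ℕ} (hm : (m : ℝ) * δ ≤ 1 / 2) : (1 + δ) ^ m - 1 ≤ 2 * ((m : ℝ) * δ) := by
  have h1 : (1 + δ) ^ m ≤ Real.exp δ ^ m := pow_le_pow_left₀ (by linarith) (by linarith [Real.add_one_le_exp δ]) m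
  have h2 : Real.exp δ ^ m = Real.exp ((m : ℝ) * δ) := by rw [← Real.exp_nat_mul]
  have hx0 : 0 ≤ (m : ℝ) * δ := mul_nonneg (Nat.cast_nonneg m) hδ
  have h3 := Real.abs_exp_sub_one_sub_id_le (x := (m : ℝ) * δ) (by rw [abs_of_nonneg hx0]; linarith)
  have h4 : Real.exp ((m : ℝ) * δ) - 1 - (m : ℝ) * δ ≤ ((m : ℝ) * δ) ^ 2 := (le_abs_self _).trans h3
  nlinarith

end RealIneq

/-! ## §2 The complexified step factors `σ_A(s)`: `e^{A_b}·U₀(b)` forward, `U₀(b)⋆·e^{−A_b}` backward -/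

section Steps

variable {P : Params} {j : ℕ} {N : ℕ} [NeZero N]

/-- The step matrices of an `SU(N)` field have norm `≤ 1`. [cite: Balaban1987RG1, (0.4) p.253 (bookkeeping)] -/
theorem norm_stepM_coeField_le_one (U₀ : GaugeField P j (SU N)) (s : LStep P j) : ‖stepM (coeField U₀) s‖ ≤ 1 := by
  unfold stepM
  split_ifs
  · exact norm_coe_SU_le_one (U₀ s.bond)
  · rw [coeField_apply, norm_star]; exact norm_coe_SU_le_one (U₀ s.bond)

omit [NeZero N] in
/-- At `A = 0` the complexified step factor is the step matrix of the background. [cite: Balaban1987RG1, (0.4) p.253 (bookkeeping)] -/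
theorem stepC_zero (U₀ : GaugeField P j (SU N)) (s : LStep P j) :
    (if s.fwd then NormedSpace.exp ((0 : PBond P j → Matrix (Fin N) (Fin N) ℂ) s.bond) * ((U₀ s.bond : SU N) : Matrix (Fin N) (Fin N) ℂ)
      else star ((U₀ s.bond : SU N) : Matrix (Fin N) (Fin N) ℂ) * NormedSpace.exp (-((0 : PBond P j → Matrix (Fin N) (Fin N) ℂ) s.bond))) =
      stepM (coeField U₀) s := by
  unfold stepM
  simp only [Pi.zero_apply, neg_zero, NormedSpace.exp_zero, one_mul, mul_one, coeField_apply]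

omit [NeZero N] in
/-- The complexified step factor is an entire (analytic) function of the complex bond field `A` (evaluation at a bond, `exp`, a constant factor).
[cite: Balaban1987RG1, p.253 («analytic function»; bookkeeping)] -/
theorem analyticAt_stepC (U₀ : GaugeField P j (SU N)) (s : LStep P j) (A₀ : PBond P j → Matrix (Fin N) (Fin N) ℂ) :
    AnalyticAt ℂ (fun A : PBond P j → Matrix (Fin N) (Fin N) ℂ =>
      if s.fwd then NormedSpace.exp (A s.bond) * ((U₀ s.bond : SU N) : Matrix (Fin N) (Fin N) ℂ)
      else star ((U₀ s.bond : SU N) : Matrix (Fin N) (Fin N) ℂ) * NormedSpace.exp (-(A s.bond))) A₀ := by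
  have hev : AnalyticAt ℂ (fun A : PBond P j → Matrix (Fin N) (Fin N) ℂ => A s.bond) A₀ :=
    (ContinuousLinearMap.proj (R := ℂ) (φ := fun _ : PBond P j => Matrix (Fin N) (Fin N) ℂ) s.bond).analyticAt A₀
  have hexp : ∀ Z : Matrix (Fin N) (Fin N) ℂ, AnalyticAt ℂ (NormedSpace.exp : Matrix (Fin N) (Fin N) ℂ → Matrix (Fin N) (Fin N) ℂ) Z :=
    fun Z => NormedSpace.exp_analytic (𝕂 := ℂ) Z
  by_cases hs : s.fwd
  · simp only [hs, if_true]
    exact ((hexp _).comp hev).mul analyticAt_const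
  · simp only [hs]
    exact analyticAt_const.mul ((hexp _).comp hev.neg)

/-- The complexified step factor moves by at most `e^{‖A‖} − 1` from the background step matrix (`‖e^{Z} − 1‖ ≤ e^{‖Z‖} − 1`, unitary factors of norm `≤ 1`).
[cite: Balaban1985Averaging, (19) p.21 (bookkeeping)] -/
theorem norm_stepC_sub_stepM_le (U₀ : GaugeField P j (SU N)) (s : LStep P j) (A : PBond P j → Matrix (Fin N) (Fin N) ℂ) :
    ‖(if s.fwd then NormedSpace.exp (A s.bond) * ((U₀ s.bond : SU N) : Matrix (Fin N) (Fin N) ℂ)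
      else star ((U₀ s.bond : SU N) : Matrix (Fin N) (Fin N) ℂ) * NormedSpace.exp (-(A s.bond))) - stepM (coeField U₀) s‖ ≤
      Real.exp ‖A‖ - 1 := by
  have hb : ‖A s.bond‖ ≤ ‖A‖ := norm_le_pi_norm A s.bond
  have hmono : Real.exp ‖A s.bond‖ - 1 ≤ Real.exp ‖A‖ - 1 := by linarith [Real.exp_le_exp.2 hb]
  have hU : ‖((U₀ s.bond : SU N) : Matrix (Fin N) (Fin N) ℂ)‖ ≤ 1 := norm_coe_SU_le_one _
  have he0 : 0 ≤ Real.exp ‖A s.bond‖ - 1 := by linarith [Real.add_one_le_exp ‖A s.bond‖, norm_nonneg (A s.bond)]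
  unfold stepM
  by_cases hs : s.fwd = true
  · rw [if_pos hs, if_pos hs, coeField_apply]
    have hsplit : NormedSpace.exp (A s.bond) * ((U₀ s.bond : SU N) : Matrix (Fin N) (Fin N) ℂ) - ((U₀ s.bond : SU N) : Matrix (Fin N) (Fin N) ℂ) =
        (NormedSpace.exp (A s.bond) - 1) * ((U₀ s.bond : SU N) : Matrix (Fin N) (Fin N) ℂ) := by noncomm_ring
    rw [hsplit]
    calc _ ≤ ‖NormedSpace.exp (A s.bond) - 1‖ * ‖((U₀ s.bond : SU N) : Matrix (Fin N) (Fin N) ℂ)‖ := norm_mul_le _ _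
      _ ≤ (Real.exp ‖A s.bond‖ - 1) * 1 := mul_le_mul (B7TransferAnalyticMean.norm_exp_sub_one_le _) hU (norm_nonneg _) he0
      _ ≤ Real.exp ‖A‖ - 1 := by rw [mul_one]; exact hmono
  · rw [if_neg hs, if_neg hs, coeField_apply]
    have hsplit : star ((U₀ s.bond : SU N) : Matrix (Fin N) (Fin N) ℂ) * NormedSpace.exp (-(A s.bond)) - star ((U₀ s.bond : SU N) : Matrix (Fin N) (Fin N) ℂ) =
        star ((U₀ s.bond : SU N) : Matrix (Fin N) (Fin N) ℂ) * (NormedSpace.exp (-(A s.bond)) - 1) := by noncomm_ring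
    rw [hsplit]
    calc _ ≤ ‖star ((U₀ s.bond : SU N) : Matrix (Fin N) (Fin N) ℂ)‖ * ‖NormedSpace.exp (-(A s.bond)) - 1‖ := norm_mul_le _ _
      _ ≤ 1 * (Real.exp ‖A s.bond‖ - 1) := by
          refine mul_le_mul (by rw [norm_star]; exact hU) ?_ (norm_nonneg _) zero_le_one
          have h := B7TransferAnalyticMean.norm_exp_sub_one_le (-(A s.bond))
          rwa [norm_neg] at h
      _ ≤ Real.exp ‖A‖ - 1 := by rw [one_mul]; exact hmono

/-- **REAL SLICE OF THE STEP FACTOR**: at `A = X̂` (`X` an `𝔰𝔲(N)`-valued bond field) the complexified step factor IS the step matrix of the chart point `Θ^B(X)·U₀`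
(`(e^{X_b}U₀(b))⋆ = U₀(b)⋆e^{−X_b}` since `X_b⋆ = −X_b`). [cite: Helgason2000, Ch. I §1 Thm. 1.14 (13) p. 96 (bookkeeping)] -/
theorem stepC_real (U₀ : GaugeField P j (SU N)) (s : LStep P j) (X : PBond P j → (specialUnitaryLogChart (Fin N)).lie) :
    (if s.fwd then NormedSpace.exp ((fun b => ((X b : (specialUnitaryLogChart (Fin N)).lie) : Matrix (Fin N) (Fin N) ℂ)) s.bond) * ((U₀ s.bond : SU N) : Matrix (Fin N) (Fin N) ℂ)
      else star ((U₀ s.bond : SU N) : Matrix (Fin N) (Fin N) ℂ) *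
        NormedSpace.exp (-((fun b => ((X b : (specialUnitaryLogChart (Fin N)).lie) : Matrix (Fin N) (Fin N) ℂ)) s.bond))) =
      stepM (coeField (fun b => (isChartRep_specialUnitaryGroup (n := Fin N)).expChart (X b) * U₀ b)) s := by
  have hskew : star (((X s.bond : (specialUnitaryLogChart (Fin N)).lie) : Matrix (Fin N) (Fin N) ℂ)) =
      -(((X s.bond : (specialUnitaryLogChart (Fin N)).lie) : Matrix (Fin N) (Fin N) ℂ)) :=
    (mem_specialUnitaryLogChart_lie.1 (X s.bond).2).1
  rw [coeField_piExpChart_translate]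
  unfold stepM
  by_cases hs : s.fwd = true
  · rw [if_pos hs, if_pos hs]
  · rw [if_neg hs, if_neg hs, star_mul, NormedSpace.star_exp, hskew]

end Steps

/-! ## §3 Complexified walk products `W_A(γ) = ∏_{s∈γ} σ_A(s)`: entire in `A`, within `e^{|γ|‖A‖} − 1` of the background holonomy, real slice = `holM` -/

section Walks

variable {P : Params} {j : ℕ} {N : ℕ} [NeZero N] (U₀ : GaugeField P j (SU N))

omit [NeZero N] in
/-- The complexified walk product is an entire (analytic) function of the complex bond field. [cite: Balaban1987RG1, p.253 («analytic function»; bookkeeping)] -/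
theorem analyticAt_holC (γ : List (LStep P j)) (A₀ : PBond P j → Matrix (Fin N) (Fin N) ℂ) :
    AnalyticAt ℂ (fun A : PBond P j → Matrix (Fin N) (Fin N) ℂ => ((γ).map (fun s : LStep P j => if s.fwd then NormedSpace.exp (A s.bond) * ((U₀ s.bond : SU N) : Matrix (Fin N) (Fin N) ℂ) else star ((U₀ s.bond : SU N) : Matrix (Fin N) (Fin N) ℂ) * NormedSpace.exp (-(A s.bond)))).prod) A₀ :=
  analyticAt_list_map_prod γ fun s _ => analyticAt_stepC U₀ s A₀

omit [NeZero N] in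
/-- At `A = 0` the complexified walk product is the matrix holonomy `holM ↑U₀ γ` of the background (`= ↑(holAt U₀ γ)`, lit `Node00.coe_holAt`).
[cite: Balaban1987RG1, (0.4) p.253 (bookkeeping)] -/
theorem holC_zero (γ : List (LStep P j)) : ((γ).map (fun s : LStep P j => if s.fwd then NormedSpace.exp ((0 : PBond P j → Matrix (Fin N) (Fin N) ℂ) s.bond) * ((U₀ s.bond : SU N) : Matrix (Fin N) (Fin N) ℂ) else star ((U₀ s.bond : SU N) : Matrix (Fin N) (Fin N) ℂ) * NormedSpace.exp (-((0 : PBond P j → Matrix (Fin N) (Fin N) ℂ) s.bond)))).prod = holM (coeField U₀) γ := by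
  unfold holM
  congr 1
  exact List.map_congr_left fun s _ => stepC_zero U₀ s

/-- The background holonomy matrices have norm `≤ 1`. [cite: Balaban1987RG1, (0.4) p.253 (bookkeeping)] -/
theorem norm_holM_coeField_le_one (γ : List (LStep P j)) : ‖holM (coeField U₀) γ‖ ≤ 1 :=
  norm_list_map_prod_le_one γ _ fun s _ => norm_stepM_coeField_le_one U₀ s

/-- **THE COMPLEXIFIED WALK PRODUCT STAYS WITHIN `e^{|γ|·‖A‖} − 1` OF THE BACKGROUND HOLONOMY** (`(1 + (e^{‖A‖} − 1))^{|γ|} − 1`).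
[cite: Balaban1985Averaging, (19)-(20) p.21 (bookkeeping)] -/
theorem norm_holC_sub_holM_le (γ : List (LStep P j)) (A : PBond P j → Matrix (Fin N) (Fin N) ℂ) :
    ‖((γ).map (fun s : LStep P j => if s.fwd then NormedSpace.exp (A s.bond) * ((U₀ s.bond : SU N) : Matrix (Fin N) (Fin N) ℂ) else star ((U₀ s.bond : SU N) : Matrix (Fin N) (Fin N) ℂ) * NormedSpace.exp (-(A s.bond)))).prod - holM (coeField U₀) γ‖ ≤ Real.exp ‖A‖ ^ γ.length - 1 := by
  have hδ : 0 ≤ Real.exp ‖A‖ - 1 := by linarith [Real.add_one_le_exp ‖A‖, norm_nonneg A]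
  have h := norm_list_map_prod_sub_le γ (fun s : LStep P j => if s.fwd then NormedSpace.exp (A s.bond) * ((U₀ s.bond : SU N) : Matrix (Fin N) (Fin N) ℂ) else star ((U₀ s.bond : SU N) : Matrix (Fin N) (Fin N) ℂ) * NormedSpace.exp (-(A s.bond))) (stepM (coeField U₀)) hδ
    (fun s _ => norm_stepC_sub_stepM_le U₀ s A) (fun s _ => norm_stepM_coeField_le_one U₀ s)
  rw [add_sub_cancel] at h
  exact h

/-- **REAL SLICE**: at `A = X̂` the complexified walk product is the matrix holonomy of the chart point `Θ^B(X)·U₀`. [cite: Helgason2000, Ch. I §1 Thm. 1.14 (13) p. 96 (bookkeeping)] -/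
theorem holC_real (γ : List (LStep P j)) (X : PBond P j → (specialUnitaryLogChart (Fin N)).lie) :
    ((γ).map (fun s : LStep P j => if s.fwd then NormedSpace.exp ((fun b => ((X b : (specialUnitaryLogChart (Fin N)).lie) : Matrix (Fin N) (Fin N) ℂ)) s.bond) * ((U₀ s.bond : SU N) : Matrix (Fin N) (Fin N) ℂ) else star ((U₀ s.bond : SU N) : Matrix (Fin N) (Fin N) ℂ) * NormedSpace.exp (-((fun b => ((X b : (specialUnitaryLogChart (Fin N)).lie) : Matrix (Fin N) (Fin N) ℂ)) s.bond)))).prod =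
      holM (coeField (fun b => (isChartRep_specialUnitaryGroup (n := Fin N)).expChart (X b) * U₀ b)) γ := by
  unfold holM
  congr 1
  exact List.map_congr_left fun s _ => stepC_real U₀ s X

/-- `e^{m‖A‖} − 1 ≤ e^{ℓ‖A‖} − 1 ≤ 2ℓ(e^{‖A‖} − 1)` for `m ≤ ℓ` and `ℓ(e^{‖A‖} − 1) ≤ 1∕2`: the walk budget at the (0.4) word length `ℓ = (d+2)L`. [folklore] -/
theorem exp_pow_sub_one_le {a : ℝ} (ha : 0 ≤ a) {m ℓ : ℕ} (hm : m ≤ ℓ) (hℓ : (ℓ : ℝ) * (Real.exp a - 1) ≤ 1 / 2) :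
    Real.exp a ^ m - 1 ≤ 2 * ((ℓ : ℝ) * (Real.exp a - 1)) := by
  have h1 : (1 : ℝ) ≤ Real.exp a := Real.one_le_exp ha
  have hmono : Real.exp a ^ m ≤ Real.exp a ^ ℓ := pow_le_pow_right₀ h1 hm
  have h2 := one_add_pow_sub_one_le (δ := Real.exp a - 1) (by linarith) hℓ
  rw [add_sub_cancel] at h2
  linarith

end Walks

/-! ## §4 At a coarse bond `c`: the loop tuple, the `exp[mean log]` factor, the relative average `G_c(A)`, and `Φ_c = log ∘ G_c` on the sup-norm polydisc -/

section OneStep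

variable {P : Params} {j : ℕ} {N : ℕ} [NeZero N] (U₀ : GaugeField P j (SU N))

/-- The inner radius of the `SU(N)` log chart is at most `1∕3`. [folklore] -/
theorem innerRadius_le_third : innerRadius (specialUnitaryLogChart (Fin N)) ≤ 1 / 3 :=
  innerRadius_le_rho.trans (by rw [specialUnitaryLogChart_ρ]; exact min_le_left _ _)

/-- The inner radius of the `SU(N)` log chart is at most the guard radius `δ_N = min(1∕3, π∕N)` of `expMeanLogSU` (`3 ≤ π`). [folklore] -/
theorem innerRadius_le_deltaSU : innerRadius (specialUnitaryLogChart (Fin N)) ≤ deltaSU (Fin N) := by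
  refine innerRadius_le_rho.trans ?_
  rw [specialUnitaryLogChart_ρ]
  unfold deltaSU
  refine min_le_min le_rfl (div_le_div_of_nonneg_right (by linarith [Real.pi_gt_three]) (Nat.cast_nonneg _))

/-- The complexified loop tuple stays within `e^{ℓ‖A‖} − 1` of the background loop matrices (`ℓ = (d+2)L` bounds every (0.4) loop word). [cite: Balaban1987RG1, (0.4) p.253] -/
theorem norm_loopTupleC_sub_le (c : PBond P (j + 1)) (A : PBond P j → Matrix (Fin N) (Fin N) ℂ) :
    ‖(fun i : Idx P => ((walk (emb c.src) (loopWord P.L c.dir (off i.1) i.2.1 i.2.2)).map (fun s : LStep P j => if s.fwd then NormedSpace.exp (A s.bond) * ((U₀ s.bond : SU N) : Matrix (Fin N) (Fin N) ℂ) else star ((U₀ s.bond : SU N) : Matrix (Fin N) (Fin N) ℂ) * NormedSpace.exp (-(A s.bond)))).prod) - (fun i : Idx P => loopM (coeField U₀) c i)‖ ≤ Real.exp ‖A‖ ^ ((P.d + 2) * P.L) - 1 := by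
  have h1 : (1 : ℝ) ≤ Real.exp ‖A‖ := Real.one_le_exp (norm_nonneg A)
  refine (pi_norm_le_iff_of_nonneg (by linarith [one_le_pow₀ (n := (P.d + 2) * P.L) h1])).2 fun i => ?_
  rw [Pi.sub_apply]
  have hlen : (walk (emb c.src) (loopWord P.L c.dir (off i.1) i.2.1 i.2.2)).length ≤ (P.d + 2) * P.L := (length_walk _ _).le.trans (length_loopWord_le c i)
  calc _ ≤ Real.exp ‖A‖ ^ (walk (emb c.src) (loopWord P.L c.dir (off i.1) i.2.1 i.2.2)).length - 1 := norm_holC_sub_holM_le U₀ _ A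
    _ ≤ Real.exp ‖A‖ ^ ((P.d + 2) * P.L) - 1 := by linarith [pow_le_pow_right₀ h1 hlen]

/-- The background loop tuple is within `α` of the identity tuple when every (0.4) loop variable of `U₀` at `c` is (`dist1 g = ‖↑g − 1‖` in the model). [cite: Balaban1985Averaging, (19) p.21 (bookkeeping)] -/
theorem norm_loopM_tuple_sub_one_le (c : PBond P (j + 1)) {α : ℝ} (hα : ∀ i, dist1 (loopHol U₀ c i) ≤ α) :
    ‖(fun i : Idx P => loopM (coeField U₀) c i) - 1‖ ≤ α := by
  have hα0 : 0 ≤ α := (GaugeGroup.dist1_nonneg _).trans (hα (Classical.arbitrary _))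
  refine (pi_norm_le_iff_of_nonneg hα0).2 fun i => ?_
  rw [Pi.sub_apply, Pi.one_apply, ← coe_loopHol]
  exact hα i

/-- The complexified straight segment stays within `e^{ℓ‖A‖} − 1` of the background segment matrix. [cite: Balaban1987RG1, (0.4) p.253] -/
theorem norm_axialC_sub_le (c : PBond P (j + 1)) (A : PBond P j → Matrix (Fin N) (Fin N) ℂ) :
    ‖((walk (emb c.src) (List.replicate P.L (c.dir, true))).map (fun s : LStep P j => if s.fwd then NormedSpace.exp (A s.bond) * ((U₀ s.bond : SU N) : Matrix (Fin N) (Fin N) ℂ) else star ((U₀ s.bond : SU N) : Matrix (Fin N) (Fin N) ℂ) * NormedSpace.exp (-(A s.bond)))).prod - axialM (coeField U₀) c‖ ≤ Real.exp ‖A‖ ^ ((P.d + 2) * P.L) - 1 := by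
  have h1 : (1 : ℝ) ≤ Real.exp ‖A‖ := Real.one_le_exp (norm_nonneg A)
  have hlen : (walk (emb c.src) (List.replicate P.L (c.dir, true))).length ≤ (P.d + 2) * P.L := length_walk_replicate_le _ _ _
  calc _ ≤ Real.exp ‖A‖ ^ (walk (emb c.src) (List.replicate P.L (c.dir, true))).length - 1 := norm_holC_sub_holM_le U₀ _ A
    _ ≤ Real.exp ‖A‖ ^ ((P.d + 2) * P.L) - 1 := by linarith [pow_le_pow_right₀ h1 hlen]

/-- ★★ **THE COMPLEXIFIED RELATIVE AVERAGE IS CLOSE TO `1` ON THE POLYDISC**: for a background in the loop `α`-guard at `c` (`4α ≤ ρ ≤` the inner radius of the log chart)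
and a complex bond field with `100·ℓ·(e^{‖A‖} − 1) ≤ ρ`, `G_c(A) = eml(W_A(loops))·W_A([c₋,c₊])·Ū(U₀)(c)⋆` satisfies `‖G_c(A) − 1‖ ≤ 27·ℓ·(e^{‖A‖} − 1)` (`eml` is `12`-Lipschitz on its polydisc,
lit `norm_eml_add_sub_eml_le`; `G_c(0) = Ū(U₀)(c)·Ū(U₀)(c)⋆ = 1` by lit `coe_avgFun_of_small`). [cite: Balaban1987RG1, (0.4), (0.8) p.253; Balaban1985Averaging, Prop. 3 p.36] -/
theorem norm_cplxRelAvg_sub_one_le (c : PBond P (j + 1)) {α ρ : ℝ} (hρ : ρ ≤ innerRadius (specialUnitaryLogChart (Fin N)))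
    (hα : ∀ i, dist1 (loopHol U₀ c i) ≤ α) (hα4 : 4 * α ≤ ρ) (A : PBond P j → Matrix (Fin N) (Fin N) ℂ)
    (hA : 100 * ((((P.d + 2) * P.L : ℕ) : ℝ) * (Real.exp ‖A‖ - 1)) ≤ ρ) :
    ‖eml (fun i : Idx P => ((walk (emb c.src) (loopWord P.L c.dir (off i.1) i.2.1 i.2.2)).map (fun s : LStep P j => if s.fwd then NormedSpace.exp (A s.bond) * ((U₀ s.bond : SU N) : Matrix (Fin N) (Fin N) ℂ) else star ((U₀ s.bond : SU N) : Matrix (Fin N) (Fin N) ℂ) * NormedSpace.exp (-(A s.bond)))).prod) * ((walk (emb c.src) (List.replicate P.L (c.dir, true))).map (fun s : LStep P j => if s.fwd then NormedSpace.exp (A s.bond) * ((U₀ s.bond : SU N) : Matrix (Fin N) (Fin N) ℂ) else star ((U₀ s.bond : SU N) : Matrix (Fin N) (Fin N) ℂ) * NormedSpace.exp (-(A s.bond)))).prod * star ((avgFun (expMeanLogSU (n := Fin N)) U₀ c : SU N) : Matrix (Fin N) (Fin N) ℂ) - 1‖ ≤ 27 * ((((P.d + 2) * P.L : ℕ) :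 ℝ) * (Real.exp ‖A‖ - 1)) := by
  set τ : ℝ := (((P.d + 2) * P.L : ℕ) : ℝ) * (Real.exp ‖A‖ - 1) with hτ
  have hρ3 : ρ ≤ 1 / 3 := hρ.trans innerRadius_le_third
  have he0 : 0 ≤ Real.exp ‖A‖ - 1 := by linarith [Real.add_one_le_exp ‖A‖, norm_nonneg A]
  have hτ0 : 0 ≤ τ := mul_nonneg (Nat.cast_nonneg _) he0
  have hα0 : 0 ≤ α := (GaugeGroup.dist1_nonneg _).trans (hα (Classical.arbitrary _))
  have hαδ : α < deltaSU (Fin N) := by linarith [innerRadius_le_deltaSU (N := N), deltaSU_pos (n := Fin N)]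
  have hsmall : Small (expMeanLogSU (n := Fin N)) U₀ c := fun i => lt_of_le_of_lt (hα i) hαδ
  -- the loop tuple
  have hT : ‖(fun i : Idx P => ((walk (emb c.src) (loopWord P.L c.dir (off i.1) i.2.1 i.2.2)).map (fun s : LStep P j => if s.fwd then NormedSpace.exp (A s.bond) * ((U₀ s.bond : SU N) : Matrix (Fin N) (Fin N) ℂ) else star ((U₀ s.bond : SU N) : Matrix (Fin N) (Fin N) ℂ) * NormedSpace.exp (-(A s.bond)))).prod) - (fun i : Idx P => loopM (coeField U₀) c i)‖ ≤ 2 * τ :=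
    (norm_loopTupleC_sub_le U₀ c A).trans (exp_pow_sub_one_le (norm_nonneg A) le_rfl (by linarith))
  have hT0 : ‖(fun i : Idx P => loopM (coeField U₀) c i) - 1‖ ≤ α := norm_loopM_tuple_sub_one_le U₀ c hα
  -- the `exp[mean log]` factor
  have hE : ‖eml (fun i : Idx P => ((walk (emb c.src) (loopWord P.L c.dir (off i.1) i.2.1 i.2.2)).map (fun s : LStep P j => if s.fwd then NormedSpace.exp (A s.bond) * ((U₀ s.bond : SU N) : Matrix (Fin N) (Fin N) ℂ) else star ((U₀ s.bond : SU N) : Matrix (Fin N) (Fin N) ℂ) * NormedSpace.exp (-(A s.bond)))).prod) - corrM (coeField U₀) c‖ ≤ 24 * τ := by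
    have h := BlockAveragingEMLAnalyticMean.norm_eml_add_sub_eml_le (ι := Idx P) (𝔸 := Matrix (Fin N) (Fin N) ℂ)
      (U := fun i : Idx P => loopM (coeField U₀) c i) (V := (fun i : Idx P => ((walk (emb c.src) (loopWord P.L c.dir (off i.1) i.2.1 i.2.2)).map (fun s : LStep P j => if s.fwd then NormedSpace.exp (A s.bond) * ((U₀ s.bond : SU N) : Matrix (Fin N) (Fin N) ℂ) else star ((U₀ s.bond : SU N) : Matrix (Fin N) (Fin N) ℂ) * NormedSpace.exp (-(A s.bond)))).prod) - (fun i : Idx P => loopM (coeField U₀) c i))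
      (by linarith) (by linarith)
    rw [add_sub_cancel] at h
    unfold corrM
    linarith
  have hE0 : ‖corrM (coeField U₀) c‖ ≤ 1 := by
    rw [← coe_corr_of_small U₀ c hsmall]; exact norm_coe_SU_le_one _
  -- the straight segment
  have hS : ‖((walk (emb c.src) (List.replicate P.L (c.dir, true))).map (fun s : LStep P j => if s.fwd then NormedSpace.exp (A s.bond) * ((U₀ s.bond : SU N) : Matrix (Fin N) (Fin N) ℂ) else star ((U₀ s.bond : SU N) : Matrix (Fin N) (Fin N) ℂ) * NormedSpace.exp (-(A s.bond)))).prod - axialM (coeField U₀) c‖ ≤ 2 * τ :=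
    (norm_axialC_sub_le U₀ c A).trans (exp_pow_sub_one_le (norm_nonneg A) le_rfl (by linarith))
  have hS0 : ‖axialM (coeField U₀) c‖ ≤ 1 := norm_holM_coeField_le_one U₀ _
  have hSA : ‖((walk (emb c.src) (List.replicate P.L (c.dir, true))).map (fun s : LStep P j => if s.fwd then NormedSpace.exp (A s.bond) * ((U₀ s.bond : SU N) : Matrix (Fin N) (Fin N) ℂ) else star ((U₀ s.bond : SU N) : Matrix (Fin N) (Fin N) ℂ) * NormedSpace.exp (-(A s.bond)))).prod‖ ≤ 1 + 2 * τ := by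
    calc ‖((walk (emb c.src) (List.replicate P.L (c.dir, true))).map (fun s : LStep P j => if s.fwd then NormedSpace.exp (A s.bond) * ((U₀ s.bond : SU N) : Matrix (Fin N) (Fin N) ℂ) else star ((U₀ s.bond : SU N) : Matrix (Fin N) (Fin N) ℂ) * NormedSpace.exp (-(A s.bond)))).prod‖ = ‖axialM (coeField U₀) c + (((walk (emb c.src) (List.replicate P.L (c.dir, true))).map (fun s : LStep P j => if s.fwd then NormedSpace.exp (A s.bond) * ((U₀ s.bond : SU N) : Matrix (Fin N) (Fin N) ℂ) else star ((U₀ s.bond : SU N) : Matrix (Fin N) (Fin N) ℂ) * NormedSpace.exp (-(A s.bond)))).prod - axialM (coeField U₀) c)‖ := by rw [add_sub_cancel]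
      _ ≤ ‖axialM (coeField U₀) c‖ + ‖((walk (emb c.src) (List.replicate P.L (c.dir, true))).map (fun s : LStep P j => if s.fwd then NormedSpace.exp (A s.bond) * ((U₀ s.bond : SU N) : Matrix (Fin N) (Fin N) ℂ) else star ((U₀ s.bond : SU N) : Matrix (Fin N) (Fin N) ℂ) * NormedSpace.exp (-(A s.bond)))).prod - axialM (coeField U₀) c‖ := norm_add_le _ _
      _ ≤ 1 + 2 * τ := add_le_add hS0 hS
  -- `G_c(0) = 1`
  have hG0 : corrM (coeField U₀) c * axialM (coeField U₀) c * star ((avgFun (expMeanLogSU (n := Fin N)) U₀ c : SU N) : Matrix (Fin N) (Fin N) ℂ) = 1 := by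
    have h := coe_avgFun_of_small U₀ c hsmall
    unfold avgM at h
    rw [← h, coe_mul_star_coe_SU]
  have hsbar : ‖star ((avgFun (expMeanLogSU (n := Fin N)) U₀ c : SU N) : Matrix (Fin N) (Fin N) ℂ)‖ ≤ 1 := by rw [norm_star]; exact norm_coe_SU_le_one _
  -- assemble
  have hsplit : eml (fun i : Idx P => ((walk (emb c.src) (loopWord P.L c.dir (off i.1) i.2.1 i.2.2)).map (fun s : LStep P j => if s.fwd then NormedSpace.exp (A s.bond) * ((U₀ s.bond : SU N) : Matrix (Fin N) (Fin N) ℂ) else star ((U₀ s.bond : SU N) : Matrix (Fin N) (Fin N) ℂ) * NormedSpace.exp (-(A s.bond)))).prod) * ((walk (emb c.src) (List.replicate P.L (c.dir, true))).map (fun s : LStep P j => if s.fwd then NormedSpace.exp (A s.bond) * ((U₀ s.bond : SU N) : Matrix (Fin N) (Fin N) ℂ) else star ((U₀ s.bond : SU N) : Matrix (Fin N) (Fin N) ℂ) * NormedSpace.exp (-(A s.bond)))).prod * star ((avgFun (expMeanLogSU (n := Fin N)) U₀ c : SU N) : Matrix (Fin N) (Fin N) ℂ) - 1 =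
      ((eml (fun i : Idx P => ((walk (emb c.src) (loopWord P.L c.dir (off i.1) i.2.1 i.2.2)).map (fun s : LStep P j => if s.fwd then NormedSpace.exp (A s.bond) * ((U₀ s.bond : SU N) : Matrix (Fin N) (Fin N) ℂ) else star ((U₀ s.bond : SU N) : Matrix (Fin N) (Fin N) ℂ) * NormedSpace.exp (-(A s.bond)))).prod) - corrM (coeField U₀) c) * ((walk (emb c.src) (List.replicate P.L (c.dir, true))).map (fun s : LStep P j => if s.fwd then NormedSpace.exp (A s.bond) * ((U₀ s.bond : SU N) : Matrix (Fin N) (Fin N) ℂ) else star ((U₀ s.bond : SU N) : Matrix (Fin N) (Fin N) ℂ) * NormedSpace.exp (-(A s.bond)))).prod +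
        corrM (coeField U₀) c * (((walk (emb c.src) (List.replicate P.L (c.dir, true))).map (fun s : LStep P j => if s.fwd then NormedSpace.exp (A s.bond) * ((U₀ s.bond : SU N) : Matrix (Fin N) (Fin N) ℂ) else star ((U₀ s.bond : SU N) : Matrix (Fin N) (Fin N) ℂ) * NormedSpace.exp (-(A s.bond)))).prod - axialM (coeField U₀) c)) * star ((avgFun (expMeanLogSU (n := Fin N)) U₀ c : SU N) : Matrix (Fin N) (Fin N) ℂ) := by
    rw [← hG0]; noncomm_ring
  rw [hsplit]
  have hτs : τ ≤ 1 / 300 := by linarith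
  calc _ ≤ ‖(eml (fun i : Idx P => ((walk (emb c.src) (loopWord P.L c.dir (off i.1) i.2.1 i.2.2)).map (fun s : LStep P j => if s.fwd then NormedSpace.exp (A s.bond) * ((U₀ s.bond : SU N) : Matrix (Fin N) (Fin N) ℂ) else star ((U₀ s.bond : SU N) : Matrix (Fin N) (Fin N) ℂ) * NormedSpace.exp (-(A s.bond)))).prod) - corrM (coeField U₀) c) * ((walk (emb c.src) (List.replicate P.L (c.dir, true))).map (fun s : LStep P j => if s.fwd then NormedSpace.exp (A s.bond) * ((U₀ s.bond : SU N) : Matrix (Fin N) (Fin N) ℂ) else star ((U₀ s.bond : SU N) : Matrix (Fin N) (Fin N) ℂ) * NormedSpace.exp (-(A s.bond)))).prod +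
        corrM (coeField U₀) c * (((walk (emb c.src) (List.replicate P.L (c.dir, true))).map (fun s : LStep P j => if s.fwd then NormedSpace.exp (A s.bond) * ((U₀ s.bond : SU N) : Matrix (Fin N) (Fin N) ℂ) else star ((U₀ s.bond : SU N) : Matrix (Fin N) (Fin N) ℂ) * NormedSpace.exp (-(A s.bond)))).prod - axialM (coeField U₀) c)‖ * ‖star ((avgFun (expMeanLogSU (n := Fin N)) U₀ c : SU N) : Matrix (Fin N) (Fin N) ℂ)‖ := norm_mul_le _ _
    _ ≤ (24 * τ * (1 + 2 * τ) + 1 * (2 * τ)) * 1 := by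
        refine mul_le_mul ?_ hsbar (norm_nonneg _) (by positivity)
        exact (norm_add_le _ _).trans (add_le_add ((norm_mul_le _ _).trans (mul_le_mul hE hSA (norm_nonneg _) (by positivity)))
          ((norm_mul_le _ _).trans (mul_le_mul hE0 hS (norm_nonneg _) zero_le_one)))
    _ ≤ 27 * τ := by nlinarith

end OneStep

end Summit.QuantumFields.YangMills.Theorems.FluctuationComparisonRegPrIntLS2BetaChartReadCplxExtension

end
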